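import Summits.Parity.GeneralizedHardyLittlewood.Theorems.PrimeLevelFamEdgeMomentsBeyondDiagonalDiagHarmonicPow
import Summits.Parity.GeneralizedHardyLittlewood.Theorems.PrimeLevelFamEdgeMomentsBeyondDiagonalDiagProfileCoord
import HarnessLib

/-!
# Route `PrimeLevelFamEdge`, crux K_A `MomentsBeyondDiagonal` (stmt-Parity-20007), line «petersson_layers» v4, stub `stub_diag`:
# **harmonic sums against a polynomial weight: `Σ_{n≤M}|W(n)|E_n·R(log(M/n)/log M) = ζ(2)·log M·∫₀¹R + O_R(1)`**

Census item G5 of the `stub_diag` repair census (`Lines/petersson_layers_stub_diag_g4_bricks.md`): the `n`-sums of the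
general-profile kernel form carry polynomial weights in `u_n = log(M/n)/log M` (`P″(u_n)²` in the `L`-term,
`P″(u_n)P′(u_n)` in the prime term) against the measure `φ(n)W(n)²E_n² = ζ(2)|W(n)|E_n`. Expanding the weight in
powers of `u_n` and feeding the harmonic engine `H_a(M) = ζ(2)log^{a+1}M/(a+1) + O_a((1+log M)ᵃ)`
(`…DiagHarmonicPow.abs_sum_absW_mainConst_log_pow_sub_le`):

* `abs_sum_absW_mainConst_mul_eval_sub_le` — **for every real polynomial `R` there is `C_R` with
  `|Σ_{n≤M}|W(n)|E_n R(log(M/n)/log M) − ζ(2)·log M·Σ_i R_i/(i+1)| ≤ C_R` for all `M ≥ 3`**;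
* `intervalIntegral_eval_eq_sum_coeff` — `∫₀¹ R = Σ_i R_i/(i+1)`, so the constant is `ζ(2)·log M·∫₀¹R(u)du`
  (`abs_sum_absW_mainConst_mul_eval_sub_integral_le`).

Def-free; theorems only. Helper `--supports stmt-Parity-20007`; closes nothing; K_A, K_B and the Parity summit are
NOT proved; nothing about Landau–Siegel zeros.

## References
* E. Kowalski, P. Michel, J. VanderKam, J. reine angew. Math. 526 (2000), Prop. 5.1 p. 18 (the integrals `∫₀¹` of (31)
  as limits of the `n`-sums). [cite: KowalskiMichelVanderKam2000, Prop. 5.1 — derivation]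
-/

noncomputable section

open scoped Real ArithmeticFunction.Moebius ArithmeticFunction.sigma ArithmeticFunction.zeta
open Finset ArithmeticFunction Polynomial MeasureTheory intervalIntegral

namespace Summit.Parity.GeneralizedHardyLittlewood.Theorems.MomentsBeyondDiagonal.DiagKernel

open Literature.NumberTheory.LFunctions Literature.NumberTheory.LFunctions.KMV2000
open MollifierMainTerm (W)
open Literature.NumberTheory.Sieve (one_le_log_of_three_le)
open Summit.Parity.GeneralizedHardyLittlewood.Theorems.BeyondDiagonalBeatsQuarter.KernelFormXSq (mainConst)

/-- **Harmonic sums against a polynomial weight**: for every real polynomial `R` there is `C_R` such that for all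
`M ≥ 3`, `|Σ_{n≤M}|W(n)|E_n·R(log(M/n)/log M) − ζ(2)·log M·Σ_{i≤deg R} R_i/(i+1)| ≤ C_R`
(expand `R(u_n) = Σ_i R_i logⁱ(M/n)/logⁱM` and use `H_i(M) = ζ(2)log^{i+1}M/(i+1) + O_i((1+log M)ⁱ)` order by order).
[cite: KowalskiMichelVanderKam2000, Prop. 5.1 — derivation (the `n`-sums of (31) against a polynomial weight)] -/
theorem abs_sum_absW_mainConst_mul_eval_sub_le (R : ℝ[X]) :
    ∃ C : ℝ, 0 < C ∧ ∀ M : ℝ, 3 ≤ M →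
      |∑ n ∈ Icc 1 ⌊M⌋₊, |W n| * mainConst n * R.eval (Real.log (M / n) / Real.log M) -
          π ^ 2 / 6 * Real.log M * ∑ i ∈ Finset.range (R.natDegree + 1), R.coeff i / ((i : ℝ) + 1)| ≤ C := by
  have hK : ∀ i : ℕ, ∃ K : ℝ, 0 < K ∧ ∀ x : ℝ, 1 ≤ x →
      |∑ n ∈ Icc 1 ⌊x⌋₊, |W n| * mainConst n * Real.log (x / n) ^ i -
          π ^ 2 / 6 * Real.log x ^ (i + 1) / ((i : ℝ) + 1)| ≤ K * (1 + Real.log x) ^ i :=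
    fun i ↦ abs_sum_absW_mainConst_log_pow_sub_le i
  choose K hK0 hK using hK
  have hsum0 : 0 ≤ ∑ i ∈ Finset.range (R.natDegree + 1), |R.coeff i| * K i * 2 ^ i :=
    Finset.sum_nonneg fun i _ ↦ by have := hK0 i; positivity
  refine ⟨∑ i ∈ Finset.range (R.natDegree + 1), |R.coeff i| * K i * 2 ^ i + 1, by linarith, fun M hM ↦ ?_⟩
  set ℓ := Real.log M with hℓ
  have hℓ1 : 1 ≤ ℓ := one_le_log_of_three_le hM
  have hℓ0 : 0 < ℓ := by linarith
  have hM1 : (1 : ℝ) ≤ M := by linarith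
  set d := R.natDegree + 1 with hd
  -- expand the weight and exchange the sums
  have hexp : ∑ n ∈ Icc 1 ⌊M⌋₊, |W n| * mainConst n * R.eval (Real.log (M / n) / ℓ) =
      ∑ i ∈ Finset.range d, R.coeff i / ℓ ^ i *
        ∑ n ∈ Icc 1 ⌊M⌋₊, |W n| * mainConst n * Real.log (M / n) ^ i := by
    have h1 : ∀ n ∈ Icc 1 ⌊M⌋₊, |W n| * mainConst n * R.eval (Real.log (M / n) / ℓ) =
        ∑ i ∈ Finset.range d, R.coeff i / ℓ ^ i * (|W n| * mainConst n * Real.log (M / n) ^ i) := by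
      intro n _
      rw [Polynomial.eval_eq_sum_range, Finset.mul_sum]
      refine Finset.sum_congr rfl fun i _ ↦ ?_
      rw [div_pow]
      field_simp
    rw [Finset.sum_congr rfl h1, Finset.sum_comm]
    refine Finset.sum_congr rfl fun i _ ↦ ?_
    rw [Finset.mul_sum]
  have hmain : π ^ 2 / 6 * ℓ * ∑ i ∈ Finset.range d, R.coeff i / ((i : ℝ) + 1) =
      ∑ i ∈ Finset.range d, R.coeff i / ℓ ^ i * (π ^ 2 / 6 * ℓ ^ (i + 1) / ((i : ℝ) + 1)) := by
    rw [Finset.mul_sum]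
    refine Finset.sum_congr rfl fun i _ ↦ ?_
    rw [pow_succ]
    field_simp
    ring
  rw [hexp, hmain, ← Finset.sum_sub_distrib]
  have hterm : ∀ i ∈ Finset.range d,
      |R.coeff i / ℓ ^ i * ∑ n ∈ Icc 1 ⌊M⌋₊, |W n| * mainConst n * Real.log (M / n) ^ i -
          R.coeff i / ℓ ^ i * (π ^ 2 / 6 * ℓ ^ (i + 1) / ((i : ℝ) + 1))| ≤ |R.coeff i| * K i * 2 ^ i := by
    intro i _
    rw [← mul_sub, abs_mul, abs_div, abs_of_pos (pow_pos hℓ0 i)]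
    have h := hK i M hM1
    have h2 : (1 + ℓ) ^ i ≤ (2 * ℓ) ^ i := pow_le_pow_left₀ (by linarith) (by linarith) i
    calc |R.coeff i| / ℓ ^ i * |∑ n ∈ Icc 1 ⌊M⌋₊, |W n| * mainConst n * Real.log (M / n) ^ i -
            π ^ 2 / 6 * ℓ ^ (i + 1) / ((i : ℝ) + 1)|
        ≤ |R.coeff i| / ℓ ^ i * (K i * (2 * ℓ) ^ i) :=
          mul_le_mul_of_nonneg_left (h.trans (mul_le_mul_of_nonneg_left h2 (hK0 i).le)) (by positivity)
      _ = |R.coeff i| * K i * 2 ^ i := by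
          rw [mul_pow]
          field_simp
  calc |∑ i ∈ Finset.range d, (R.coeff i / ℓ ^ i * ∑ n ∈ Icc 1 ⌊M⌋₊, |W n| * mainConst n * Real.log (M / n) ^ i -
          R.coeff i / ℓ ^ i * (π ^ 2 / 6 * ℓ ^ (i + 1) / ((i : ℝ) + 1)))|
      ≤ ∑ i ∈ Finset.range d, |R.coeff i / ℓ ^ i * ∑ n ∈ Icc 1 ⌊M⌋₊, |W n| * mainConst n * Real.log (M / n) ^ i -
          R.coeff i / ℓ ^ i * (π ^ 2 / 6 * ℓ ^ (i + 1) / ((i : ℝ) + 1))| := Finset.abs_sum_le_sum_abs _ _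
    _ ≤ ∑ i ∈ Finset.range d, |R.coeff i| * K i * 2 ^ i := Finset.sum_le_sum hterm
    _ ≤ ∑ i ∈ Finset.range d, |R.coeff i| * K i * 2 ^ i + 1 := by linarith

/-- **`∫₀¹ R(u)du = Σ_{i≤deg R} R_i/(i+1)`** for a real polynomial `R`. [folklore] -/
theorem intervalIntegral_eval_eq_sum_coeff (R : ℝ[X]) :
    ∫ u in (0 : ℝ)..1, R.eval u = ∑ i ∈ Finset.range (R.natDegree + 1), R.coeff i / ((i : ℝ) + 1) := by
  have h1 : (fun u : ℝ ↦ R.eval u) = fun u ↦ ∑ i ∈ Finset.range (R.natDegree + 1), R.coeff i * u ^ i := by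
    funext u
    rw [Polynomial.eval_eq_sum_range]
  have hint : ∀ i ∈ Finset.range (R.natDegree + 1),
      IntervalIntegrable (fun u : ℝ ↦ R.coeff i * u ^ i) volume 0 1 := fun i _ ↦
    (continuous_const.mul (continuous_pow i)).intervalIntegrable 0 1
  rw [h1, intervalIntegral.integral_finsetSum hint]
  refine Finset.sum_congr rfl fun i _ ↦ ?_
  rw [intervalIntegral.integral_const_mul, integral_pow]
  simp [div_eq_mul_inv]

/-- **Harmonic sums against a polynomial weight, integral form**: for every real polynomial `R` there is `C_R` with
`|Σ_{n≤M}|W(n)|E_n·R(log(M/n)/log M) − ζ(2)·log M·∫₀¹R(u)du| ≤ C_R` for all `M ≥ 3`.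
[cite: KowalskiMichelVanderKam2000, Prop. 5.1 — derivation (the integrals `∫₀¹` of (31))] -/
theorem abs_sum_absW_mainConst_mul_eval_sub_integral_le (R : ℝ[X]) :
    ∃ C : ℝ, 0 < C ∧ ∀ M : ℝ, 3 ≤ M →
      |∑ n ∈ Icc 1 ⌊M⌋₊, |W n| * mainConst n * R.eval (Real.log (M / n) / Real.log M) -
          π ^ 2 / 6 * Real.log M * ∫ u in (0 : ℝ)..1, R.eval u| ≤ C := by
  obtain ⟨C, hC, h⟩ := abs_sum_absW_mainConst_mul_eval_sub_le R
  refine ⟨C, hC, fun M hM ↦ ?_⟩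
  rw [intervalIntegral_eval_eq_sum_coeff]
  exact h M hM

end Summit.Parity.GeneralizedHardyLittlewood.Theorems.MomentsBeyondDiagonal.DiagKernel

end
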